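import Mathlib
import HarnessLib
import Summits.NavierStokesRegularity.NavierStokesRegularity.Theorems.WakeRatchetMinimalViscousBlowupShellFence
import Summits.NavierStokesRegularity.NavierStokesRegularity.Theorems.WakeRatchetMinimalViscousBlowupSupLevelMaxPrinciple

/-!
# Route `WakeRatchet`, crux `MinimalViscousBlowup` (stmt-NavierStokesRegularity-22743) — LINE g12-2 (ns-idea-1 g12, card «monotone quantity hunt»):
# RE-IGNITION, part 2/5 — the UPPER-BLOCK bootstrap and maximum principle (closed valve with dark data above)

ns-idea-1 g12's kernel-checked file `lines/g12-2/Reignition.lean` (sha16 d946145192243467, 872 l.; evidence on ⟨22743⟩), landed VERBATIM by the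
hand ns-qj-p1 g7 in five tree-sized files (decl texts byte-identical; only the module docstrings are split):
`…ShellFence` (§1–§2) · `…UpperBlock` (§3) · `…Reignition` (§4) · `…LevelGrowth` (§5) · `…RetreatDepth` (§6).
MODEL lattice only (Tao's NS-scaled `ν`-viscous cascade lattice, `m = 4`; nothing about Navier–Stokes; no NS regularity statement is proved).
`--supports stmt-NavierStokesRegularity-22743 --as helper`.

* `upperBlock_bootstrap` — if on `[t₀,x]` the valve shell `k` and all shells `> k` are at level `≤ L₁ < ν²/16384`, and the shells `> k` are
  `≤ L₀` at `t₀`, then the shells `> k` are `≤ max(L₀, 16384 L₁²/ν²)` on `[t₀,x]` (`shell_fence` with `V = L₁`);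
* `upperBlock_maxPrinciple` — CLOSED VALVE WITH DARK DATA ABOVE: if shell `k` stays `≤ L₁` on `[t₀,t]` and the shells `> k` are `≤ L₀ < L₁`
  at `t₀`, they stay `≤ max(L₀, 16384 L₁²/ν²) < L₁` on `[t₀,t]` (real induction on the upper block only — the lit wake below `k` is irrelevant).
[cite: Tao2016AveragedNS, §4 (4.1)–(4.3), Lemma 4.1 (4.5), §5; BarbatoMorandinRomito2011, §3.1]
-/

noncomputable section

set_option linter.dupNamespace false

open Set Filter Topology
open Literature.Analysis.FluidPDE Literature.Analysis.FluidPDE.TaoCascade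

namespace Summit.NavierStokesRegularity.NavierStokesRegularity.Theorems.MinimalViscousBlowup.ThresholdRay

/-! ### §3 The upper-block bootstrap and maximum principle (closed valve with dark data above) -/

/-- **Upper-block bootstrap.**  If on `[t₀,x]` the valve shell `k` and all shells `> k` are at level `≤ L₁ < ν²/16384`, and the shells `> k`
are `≤ L₀` at `t₀`, then the shells `> k` are `≤ max(L₀, 16384 L₁²/ν²)` on `[t₀,x]` (`shell_fence` with `V = L₁`). [folklore] -/
theorem upperBlock_bootstrap {ε₀ ν T' L₀ L₁ t₀ x : ℝ} (hε : 0 < ε₀) (hν : 0 < ν)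
    {α : Fin 4 → Fin 4 → Fin 4 → ℤ × ℤ × ℤ → ℝ} (hcan : IsCancellingCoeff α)
    (hα1 : ∀ i₁ i₂ i₃, |α i₁ i₂ i₃ (0, 0, 1)| ≤ 1) {X : Fin 4 → ℤ → ℝ → ℝ}
    (hder : ∀ (i : Fin 4) (k : ℤ), ∀ t ∈ Icc 0 T', HasDerivWithinAt (X i k)
      (quadTerm ε₀ α X i k t - ν * (1 + ε₀) ^ ((2 : ℝ) * k) * X i k t) (Icc 0 T') t)
    (ht₀ : 0 ≤ t₀) (hxT' : x < T') {k : ℕ}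
    (hL₁0 : 0 ≤ L₁) (hL₁ : L₁ < ν ^ 2 / 16384)
    (hvalve : ∀ τ ∈ Icc t₀ x, (1 + ε₀) ^ k * ‖shellVec X k τ‖ ^ 2 ≤ L₁)
    (h0 : ∀ m : ℕ, k < m → (1 + ε₀) ^ m * ‖shellVec X m t₀‖ ^ 2 ≤ L₀)
    (hyp : ∀ τ ∈ Icc t₀ x, ∀ m : ℕ, k < m → (1 + ε₀) ^ m * ‖shellVec X m τ‖ ^ 2 ≤ L₁) :
    ∀ τ ∈ Icc t₀ x, ∀ m : ℕ, k < m →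
      (1 + ε₀) ^ m * ‖shellVec X m τ‖ ^ 2 ≤ max L₀ (16384 * L₁ ^ 2 / ν ^ 2) := by
  intro τ hτ m hkm
  obtain ⟨n, rfl⟩ := Nat.exists_eq_add_one_of_ne_zero (show m ≠ 0 by omega)
  have hlo : ∀ τ ∈ Icc t₀ x, (1 + ε₀) ^ n * ‖shellVec X n τ‖ ^ 2 ≤ L₁ := by
    intro τ' hτ'
    rcases Nat.lt_or_ge k n with hkn | hkn
    · exact hyp τ' hτ' n hkn
    · have hnk : n = k := by omega
      subst hnk
      exact hvalve τ' hτ'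
  have hup : ∀ τ ∈ Icc t₀ x, (1 + ε₀) ^ (n + 2) * ‖shellVec X ((n + 2 : ℕ) : ℤ) τ‖ ^ 2 ≤ L₁ :=
    fun τ' hτ' => hyp τ' hτ' (n + 2) (by omega)
  have hF : 16384 * L₁ ^ 2 ≤ ν ^ 2 * max L₀ (16384 * L₁ ^ 2 / ν ^ 2) :=
    calc 16384 * L₁ ^ 2 = ν ^ 2 * (16384 * L₁ ^ 2 / ν ^ 2) := by field_simp
      _ ≤ ν ^ 2 * max L₀ (16384 * L₁ ^ 2 / ν ^ 2) := mul_le_mul_of_nonneg_left (le_max_right _ _) (by positivity)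
  exact shell_fence hε hν hcan hα1 hder ht₀ hxT' hL₁0 hL₁0 hL₁ hF hlo hup
    ((h0 (n + 1) hkm).trans (le_max_left _ _)) τ hτ

/-- **Upper-block maximum principle (closed valve with dark data above).**  For a regular trajectory of the `ν`-viscous lattice on `[0,T)`
(cancelling table, `|α_{··(0,0,1)}| ≤ 1`): if the valve shell `k` stays at level `≤ L₁` on `[t₀,t]` (`t < T`) and at `t₀` every shell `> k`
is at level `≤ L₀`, with `0 ≤ L₀ < L₁ < ν²/16384`, then every shell `> k` stays at level `≤ max(L₀, 16384L₁²/ν²)` (`< L₁`) on `[t₀,t]` —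
whatever the (possibly lit) shells `< k` do.  Real induction on the clamped set "the shells `k < m < n₀` are `≤ L₁` so far" (closed by
continuity, the tail `≥ n₀` being `< L₁` on `[0,T']` by the weight-10 bound), improved by `upperBlock_bootstrap`, hence open to the right.
[cite: Tao2016AveragedNS, §4 (4.1)–(4.3), §5; BarbatoMorandinRomito2011, §3.1] -/
theorem upperBlock_maxPrinciple {ε₀ ν T L₀ L₁ t₀ t : ℝ} (hε : 0 < ε₀) (hν : 0 < ν)
    {α : Fin 4 → Fin 4 → Fin 4 → ℤ × ℤ × ℤ → ℝ} (hcan : IsCancellingCoeff α)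
    (hα1 : ∀ i₁ i₂ i₃, |α i₁ i₂ i₃ (0, 0, 1)| ≤ 1) {X : Fin 4 → ℤ → ℝ → ℝ}
    (hcd : ∀ i n, ContDiffOn ℝ 1 (X i n) (Ico 0 T))
    (hmot : ∀ i n t, 0 ≤ t → t < T → derivWithin (X i n) (Ici 0) t =
      quadTerm ε₀ α X i n t - ν * (1 + ε₀) ^ ((2 : ℝ) * n) * X i n t)
    (hreg : ∀ T' : ℝ, 0 < T' → T' < T → ∃ M : ℝ, ∀ t : ℝ, 0 ≤ t → t ≤ T' →
      ∀ (i : Fin 4) (n : ℤ), (1 + (1 + ε₀) ^ ((10 : ℝ) * n)) * |X i n t| ≤ M)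
    (ht₀ : 0 ≤ t₀) (ht₀t : t₀ ≤ t) (htT : t < T) {k : ℕ}
    (hL₀0 : 0 ≤ L₀) (hL₀₁ : L₀ < L₁) (hL₁ : L₁ < ν ^ 2 / 16384)
    (hvalve : ∀ τ, t₀ ≤ τ → τ ≤ t → (1 + ε₀) ^ k * ‖shellVec X k τ‖ ^ 2 ≤ L₁)
    (h0 : ∀ m : ℕ, k < m → (1 + ε₀) ^ m * ‖shellVec X m t₀‖ ^ 2 ≤ L₀) :
    ∀ τ, t₀ ≤ τ → τ ≤ t → ∀ m : ℕ, k < m →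
      (1 + ε₀) ^ m * ‖shellVec X m τ‖ ^ 2 ≤ max L₀ (16384 * L₁ ^ 2 / ν ^ 2) := by
  have hl0 : (0 : ℝ) < 1 + ε₀ := by linarith
  have hl1 : (1 : ℝ) < 1 + ε₀ := by linarith
  have hL₁0 : 0 < L₁ := lt_of_le_of_lt hL₀0 hL₀₁
  -- the improved level `K < L₁`
  set K : ℝ := max L₀ (16384 * L₁ ^ 2 / ν ^ 2) with hK
  have hKL₁ : K < L₁ := by
    have hG : 16384 * L₁ ^ 2 / ν ^ 2 < L₁ := by
      rw [div_lt_iff₀ (by positivity)]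
      rw [lt_div_iff₀ (by norm_num)] at hL₁
      nlinarith
    exact max_lt hL₀₁ hG
  -- the window `[0,T']`
  set T' : ℝ := (t + T) / 2 with hT'
  have hT'0 : 0 < T' := by rw [hT']; linarith
  have htT' : t < T' := by rw [hT']; linarith
  have hT'T : T' < T := by rw [hT']; linarith
  obtain ⟨M₀, hM₀⟩ := hreg T' hT'0 hT'T
  set M : ℝ := max M₀ 0 with hMdef
  have hM0 : 0 ≤ M := le_max_right _ _
  have hM : ∀ s, 0 ≤ s → s ≤ T' → ∀ (i : Fin 4) (n : ℤ), (1 + (1 + ε₀) ^ ((10 : ℝ) * n)) * |X i n s| ≤ M :=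
    fun s hs0 hsT' i n => (hM₀ s hs0 hsT' i n).trans (le_max_left _ _)
  have hder := hasDerivWithinAt_window_of_clauses (ε₀ := ε₀) (ν := ν) (α := α) hcd hmot hT'T
  clear_value K T' M
  -- tail shells are `≤ L₁` throughout `[0,T']`
  obtain ⟨n₀, hn₀⟩ := levels_tail_lt hε hM0 hM hL₁0
  have htail : ∀ s, 0 ≤ s → s ≤ T' → ∀ m : ℕ, n₀ ≤ m → (1 + ε₀) ^ m * ‖shellVec X m s‖ ^ 2 ≤ L₁ :=
    fun s hs0 hsT' m hm => (hn₀ s hs0 hsT' m hm).le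
  have hlev_eq : ∀ (m : ℕ) (z : ℝ), (1 + ε₀) ^ m * ‖shellVec X m z‖ ^ 2 = (1 + ε₀) ^ m * ∑ i : Fin 4, X i m z ^ 2 := by
    intro m z
    rw [norm_shellVec_sq]
  have hXc : ∀ (i : Fin 4) (k : ℤ), ContinuousOn (X i k) (Icc t₀ t) := fun i k =>
    (hcd i k).continuousOn.mono fun w hw => ⟨ht₀.trans hw.1, lt_of_le_of_lt hw.2 htT⟩
  -- the induction set (clamped form)
  set H : Set ℝ := {y | ∀ τ ∈ Icc t₀ t, ∀ m : ℕ, k < m → m < n₀ →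
      (1 + ε₀) ^ m * ‖shellVec X m (min τ y)‖ ^ 2 ≤ L₁} with hH
  have hread : ∀ y ∈ Icc t₀ t, y ∈ H → ∀ τ ∈ Icc t₀ y, ∀ m : ℕ, k < m →
      (1 + ε₀) ^ m * ‖shellVec X m τ‖ ^ 2 ≤ L₁ := by
    intro y hy hyH τ hτ m hkm
    by_cases hm : m < n₀
    · have := hyH τ ⟨hτ.1, hτ.2.trans hy.2⟩ m hkm hm
      rwa [min_eq_left hτ.2] at this
    · exact htail τ (ht₀.trans hτ.1) ((hτ.2.trans hy.2).trans htT'.le) m (not_lt.1 hm)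
  have himp : ∀ y ∈ Icc t₀ t, y ∈ H → ∀ τ ∈ Icc t₀ y, ∀ m : ℕ, k < m →
      (1 + ε₀) ^ m * ‖shellVec X m τ‖ ^ 2 ≤ K := by
    intro y hy hyH
    have := upperBlock_bootstrap hε hν hcan hα1 hder ht₀ (lt_of_le_of_lt hy.2 htT') hL₁0.le hL₁
      (fun τ hτ => hvalve τ hτ.1 (hτ.2.trans hy.2)) h0 (hread y hy hyH)
    rw [← hK] at this
    exact this
  have h0H : t₀ ∈ H := by
    intro τ hτ m hkm _
    rw [min_eq_right hτ.1]
    exact (h0 m hkm).trans hL₀₁.le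
  have hclosed : IsClosed (H ∩ Icc t₀ t) := by
    have hlevc : ∀ τ ∈ Icc t₀ t, ∀ m : ℕ,
        ContinuousOn (fun y => (1 + ε₀) ^ m * ‖shellVec X m (min τ y)‖ ^ 2) (Icc t₀ t) := by
      intro τ hτ m
      have hmin : ContinuousOn (fun y : ℝ => min τ y) (Icc t₀ t) := (continuous_const.min continuous_id).continuousOn
      have hmaps : MapsTo (fun y : ℝ => min τ y) (Icc t₀ t) (Icc t₀ t) := fun y hy =>
        ⟨le_min hτ.1 hy.1, (min_le_right _ _).trans hy.2⟩
      have heqf : (fun y => (1 + ε₀) ^ m * ‖shellVec X m (min τ y)‖ ^ 2) =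
          fun y => (1 + ε₀) ^ m * ∑ i : Fin 4, X i m (min τ y) ^ 2 := by
        funext y
        exact hlev_eq m (min τ y)
      rw [heqf]
      exact continuousOn_const.mul (continuousOn_finsetSum _ fun i _ => ((hXc i m).comp hmin hmaps).pow 2)
    have heq : H ∩ Icc t₀ t = Icc t₀ t ∩ ⋂ τ ∈ Icc t₀ t, ⋂ m ∈ {m : ℕ | k < m ∧ m < n₀},
        (Icc t₀ t ∩ (fun y => (1 + ε₀) ^ m * ‖shellVec X m (min τ y)‖ ^ 2) ⁻¹' Iic L₁) := by
      ext y
      simp only [hH, mem_inter_iff, mem_iInter, mem_setOf_eq, mem_preimage, mem_Iic]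
      constructor
      · rintro ⟨hyH, hy⟩
        exact ⟨hy, fun τ hτ m hm => ⟨hy, hyH τ hτ m hm.1 hm.2⟩⟩
      · rintro ⟨hy, h⟩
        exact ⟨fun τ hτ m hkm hm => (h τ hτ m ⟨hkm, hm⟩).2, hy⟩
    rw [heq]
    exact isClosed_Icc.inter (isClosed_biInter fun τ hτ => isClosed_biInter fun m _ =>
      (hlevc τ hτ m).preimage_isClosed_of_isClosed isClosed_Icc isClosed_Iic)
  have hstep : ∀ y ∈ H ∩ Ico t₀ t, H ∈ 𝓝[>] y := by
    rintro y ⟨hyH, hy⟩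
    have hyI : y ∈ Icc t₀ t := Ico_subset_Icc_self hy
    have hK' := himp y hyI hyH
    have hy0 : 0 ≤ y := ht₀.trans hy.1
    have hyT : y < T := lt_of_lt_of_le hy.2 htT.le
    have hcw : ∀ m : ℕ, Tendsto (fun z => (1 + ε₀) ^ m * ∑ i : Fin 4, X i m z ^ 2) (𝓝[>] y)
        (𝓝 ((1 + ε₀) ^ m * ∑ i : Fin 4, X i m y ^ 2)) := by
      intro m
      have hXw : ∀ i : Fin 4, ContinuousWithinAt (X i m) (Ioi y) y := fun i =>
        ((hcd i m).continuousOn y ⟨hy0, hyT⟩).mono_of_mem_nhdsWithin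
          (mem_of_superset (Ioo_mem_nhdsGT hyT) fun z hz => ⟨hy0.trans hz.1.le, hz.2⟩)
      exact (tendsto_finsetSum _ fun i _ => ((hXw i).pow 2).tendsto).const_mul _
    have hev : ∀ᶠ z in 𝓝[>] y, ∀ m ∈ Finset.range n₀, k < m →
        (1 + ε₀) ^ m * ∑ i : Fin 4, X i m z ^ 2 < L₁ := by
      refine (eventually_all_finset _).2 fun m hm => ?_
      by_cases hkm : k < m
      · have hlt : (1 + ε₀) ^ m * ∑ i : Fin 4, X i m y ^ 2 < L₁ := by
          rw [← hlev_eq]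
          exact (hK' y ⟨hy.1, le_rfl⟩ m hkm).trans_lt hKL₁
        exact ((hcw m).eventually_lt_const hlt).mono fun z hz _ => hz
      · exact Eventually.of_forall fun z h => absurd h hkm
    obtain ⟨u, hu, hsub⟩ := mem_nhdsGT_iff_exists_Ioo_subset.1 hev
    refine mem_of_superset (Ioo_mem_nhdsGT hu) fun z hz => ?_
    intro τ hτ m hkm hm
    rcases le_or_gt (min τ z) y with h | h
    · have := hyH (min τ z) ⟨le_min hτ.1 (hy.1.trans hz.1.le), (min_le_left _ _).trans hτ.2⟩ m hkm hm
      rwa [min_eq_left h] at this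
    · have hmem : min τ z ∈ Ioo y u := ⟨h, lt_of_le_of_lt (min_le_right _ _) hz.2⟩
      have := hsub hmem m (Finset.mem_range.2 hm) hkm
      rw [hlev_eq]
      exact this.le
  have hIcc : Icc t₀ t ⊆ H := hclosed.Icc_subset_of_forall_mem_nhdsWithin h0H hstep
  intro τ hτ0 hτt m hkm
  exact himp t ⟨ht₀t, le_rfl⟩ (hIcc ⟨ht₀t, le_rfl⟩) τ ⟨hτ0, hτt⟩ m hkm

end Summit.NavierStokesRegularity.NavierStokesRegularity.Theorems.MinimalViscousBlowup.ThresholdRay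

end
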